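import Literature.Probability.RandomPlanarGeometry.SAWSubBallistic
import Literature.Probability.RandomPlanarGeometry.BDGS2012MeanSqDisplacement
import HarnessLib

/-!
# Duminil-Copin–Hammond 2013, Corollary 1.2: `n^{-2} ⟨‖γ_n‖²⟩ → 0` (from Theorem 1.1)

Topic `Literature/Probability/RandomPlanarGeometry` (continues `SAWSubBallistic.lean`: the named fact
`DuminilCopinHammond2013_thm1_1`, the event `maxDisplacementEvent d n v = {γ ∈ SAW_n : max_k ‖γ_k‖ ≥ vn}`,
`euclidNorm`; and `BDGS2012MeanSqDisplacement.lean`: `normSq_le_sq_length`, `|ω(n)|² ≤ n²`).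
Source: H. Duminil-Copin, A. Hammond, *Self-avoiding walk is sub-ballistic*, Comm. Math. Phys. 324
(2013) 401–423 = arXiv:1205.0401 (held text `paper:arxiv-1205.0401`), §1.1, immediately after
Theorem 1.1 (p0003:L22–L29): "An alternative way to describe a walk as being ballistic is to say that
its endpoint displacement ‖γ_n‖ is comparable to its length … **Corollary 1.2.** We have that
lim_n n^{-2} ⟨‖γ_n‖²⟩ = 0, where ⟨·⟩ denotes the expectation with respect to P_{SAW_n}" —
`P_{SAW_n}` the uniform law on the `n`-step self-avoiding walks from `0` in `ℤ^d`, `d ≥ 2`, `‖·‖` the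
Euclidean norm (p0003:L8–L13).

## What is here (namespace `Literature.Probability.RandomPlanarGeometry.SAW.Zd`)

* `meanSqEndpoint d n := (Σ_{γ ∈ SAW_n} ‖γ_n‖²) / cₙ` — the printed `⟨‖γ_n‖²⟩` (a definition with a
  body; for `λ = 1` it is the mean-square displacement of `BDGS2012.lean`, not re-proved here);
* (private) `euclidNorm_sq_apply_le` — `‖γ_k‖² ≤ k²` for `γ ∈ SAW_n`, `k ≤ n` (`normSq_le_sq_length`);
* `meanSqEndpoint_div_sq_le` — the one-line estimate of the printed proof: for `n ≥ 1`,
  `n^{-2}⟨‖γ_n‖²⟩ ≤ v² + P_{SAW_n}(max_k ‖γ_k‖ ≥ vn)` (split `SAW_n` along the event of Theorem 1.1: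
  on the event `‖γ_n‖² ≤ n²`, off it `‖γ_n‖ < vn`);
* **`DuminilCopinHammond2013_cor1_2`** — Corollary 1.2 AS PRINTED, PROVED from the named fact
  `(h : DuminilCopinHammond2013_thm1_1)`: for every `d ≥ 2`, `n^{-2}⟨‖γ_n‖²⟩ → 0`.

No new named facts (debt 0): the corollary is a theorem conditional on the already-vendored Theorem 1.1.
-/

noncomputable section

open Filter Topology Finset Literature.Probability.LatticeModels Literature.Probability.Percolation SimpleGraph
open scoped BigOperators

namespace Literature.Probability.RandomPlanarGeometry.SAW.Zd

variable {d : ℕ}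

/-- **`⟨‖γ_n‖²⟩`**: "⟨·⟩ denotes the expectation with respect to P_{SAW_n}" (uniform on the `n`-step
self-avoiding walks from `0` in `ℤ^d`), applied to the squared Euclidean endpoint displacement:
`(Σ_{γ ∈ SAW_n} ‖γ_n‖²)/cₙ`. [cite: DuminilCopinHammond2013, Cor 1.2 (§1.1)] -/
def meanSqEndpoint (d n : ℕ) : ℝ :=
  (∑ ω ∈ saws d n, euclidNorm (ω n) ^ 2) / (count d n : ℝ)

/-- `⟨‖γ_n‖²⟩ ≥ 0`. [cite: DuminilCopinHammond2013, Cor 1.2 (§1.1)] -/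
theorem meanSqEndpoint_nonneg (d n : ℕ) : 0 ≤ meanSqEndpoint d n :=
  div_nonneg (sum_nonneg fun _ _ => sq_nonneg _) (Nat.cast_nonneg _)

/-- `‖γ_k‖² ≤ k²` for an `n`-step self-avoiding walk `γ` from `0` and `k ≤ n` (`k` nearest-neighbour
steps; `normSq_le_sq_length`). [folklore] -/
private theorem euclidNorm_sq_apply_le {n : ℕ} {ω : ℕ → Site d} (hω : ω ∈ saws d n) {k : ℕ} (hk : k ≤ n) :
    euclidNorm (ω k) ^ 2 ≤ (k : ℝ) ^ 2 := by
  obtain ⟨h0, -, hadj, -⟩ := mem_saws.1 hω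
  have hadj' : ∀ i < k, (zdGraph d).Adj (ω i) (ω (i + 1)) := fun i hi => hadj i (by omega)
  have := normSq_le_sq_length ((walkOfFn ω k hadj').copy h0 rfl)
  rw [Walk.length_copy, length_walkOfFn] at this
  rw [sq_euclidNorm]
  exact this

/-- **The estimate of the printed proof**: for `n ≥ 1` and real `v`,
`n^{-2}⟨‖γ_n‖²⟩ ≤ v² + #{γ ∈ SAW_n : max_k ‖γ_k‖ ≥ vn}/cₙ` — on the event `‖γ_n‖² ≤ n²`, off the event
`‖γ_n‖ < vn`. [cite: DuminilCopinHammond2013, Cor 1.2 (§1.1)] -/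
theorem meanSqEndpoint_div_sq_le [NeZero d] {n : ℕ} (hn : 1 ≤ n) (v : ℝ) :
    meanSqEndpoint d n / (n : ℝ) ^ 2 ≤
      v ^ 2 + ((maxDisplacementEvent d n v).card : ℝ) / (count d n : ℝ) := by
  classical
  have hc : (0 : ℝ) < count d n := by exact_mod_cast one_le_count d n
  have hn' : (0 : ℝ) < (n : ℝ) ^ 2 := by positivity
  -- split the sum along the event
  set E := maxDisplacementEvent d n v with hE
  have hEdef : E = (saws d n).filter fun ω => ∃ k ≤ n, v * n ≤ euclidNorm (ω k) := rfl
  have hsplit := Finset.sum_filter_add_sum_filter_not (saws d n)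
    (fun ω => ∃ k ≤ n, v * n ≤ euclidNorm (ω k)) (fun ω => euclidNorm (ω n) ^ 2)
  -- on the event: ‖γ_n‖² ≤ n²
  have hon : ∑ ω ∈ (saws d n).filter (fun ω => ∃ k ≤ n, v * n ≤ euclidNorm (ω k)),
      euclidNorm (ω n) ^ 2 ≤ (E.card : ℝ) * (n : ℝ) ^ 2 := by
    rw [hEdef]
    calc ∑ ω ∈ (saws d n).filter (fun ω => ∃ k ≤ n, v * n ≤ euclidNorm (ω k)), euclidNorm (ω n) ^ 2
        ≤ ∑ ω ∈ (saws d n).filter (fun ω => ∃ k ≤ n, v * n ≤ euclidNorm (ω k)), (n : ℝ) ^ 2 :=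
          sum_le_sum fun ω hω => euclidNorm_sq_apply_le (mem_filter.1 hω).1 le_rfl
      _ = _ := by rw [sum_const, nsmul_eq_mul]
  -- off the event: ‖γ_n‖ < vn
  have hoff : ∑ ω ∈ (saws d n).filter (fun ω => ¬ ∃ k ≤ n, v * n ≤ euclidNorm (ω k)),
      euclidNorm (ω n) ^ 2 ≤ (count d n : ℝ) * (v * n) ^ 2 := by
    calc ∑ ω ∈ (saws d n).filter (fun ω => ¬ ∃ k ≤ n, v * n ≤ euclidNorm (ω k)), euclidNorm (ω n) ^ 2
        ≤ ∑ ω ∈ (saws d n).filter (fun ω => ¬ ∃ k ≤ n, v * n ≤ euclidNorm (ω k)), (v * n) ^ 2 := by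
          refine sum_le_sum fun ω hω => ?_
          have hlt : euclidNorm (ω n) < v * n := by
            by_contra hge
            exact (mem_filter.1 hω).2 ⟨n, le_rfl, not_lt.1 hge⟩
          exact pow_le_pow_left₀ (euclidNorm_nonneg _) hlt.le 2
      _ = (((saws d n).filter (fun ω => ¬ ∃ k ≤ n, v * n ≤ euclidNorm (ω k))).card : ℝ) * (v * n) ^ 2 := by
          rw [sum_const, nsmul_eq_mul]
      _ ≤ (count d n : ℝ) * (v * n) ^ 2 := by
          gcongr
          rw [← card_saws]
          exact_mod_cast card_filter_le _ _
  have hsum : ∑ ω ∈ saws d n, euclidNorm (ω n) ^ 2 ≤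
      (E.card : ℝ) * (n : ℝ) ^ 2 + (count d n : ℝ) * (v * n) ^ 2 := by
    rw [← hsplit]
    exact add_le_add hon hoff
  -- divide by cₙ n²
  rw [meanSqEndpoint, div_div, div_le_iff₀ (by positivity)]
  calc ∑ ω ∈ saws d n, euclidNorm (ω n) ^ 2
      ≤ (E.card : ℝ) * (n : ℝ) ^ 2 + (count d n : ℝ) * (v * n) ^ 2 := hsum
    _ = (v ^ 2 + (E.card : ℝ) / (count d n : ℝ)) * ((count d n : ℝ) * (n : ℝ) ^ 2) := by
        field_simp
        ring

/-- **Duminil-Copin–Hammond 2013, Corollary 1.2** (AS PRINTED; PROVED from the named fact Theorem 1.1):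
"We have that lim_n n^{-2} ⟨‖γ_n‖²⟩ = 0, where ⟨·⟩ denotes the expectation with respect to
P_{SAW_n}" — for every `d ≥ 2`. Proof as in the source (immediate from Theorem 1.1): for each `v > 0`,
`n^{-2}⟨‖γ_n‖²⟩ ≤ v² + e^{-εn}` for `n ≥ n₀(v)`. [cite: DuminilCopinHammond2013, Cor 1.2 (§1.1)] -/
theorem DuminilCopinHammond2013_cor1_2 (h : DuminilCopinHammond2013_thm1_1) {d : ℕ} [NeZero d]
    (hd : 2 ≤ d) :
    Tendsto (fun n : ℕ => meanSqEndpoint d n / (n : ℝ) ^ 2) atTop (𝓝 0) := by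
  rw [Metric.tendsto_atTop]
  intro δ hδ
  -- choose v with v² = δ/3
  set v : ℝ := Real.sqrt (δ / 3) with hv
  have hvpos : 0 < v := Real.sqrt_pos.2 (by positivity)
  have hv2 : v ^ 2 = δ / 3 := Real.sq_sqrt (by positivity)
  obtain ⟨ε, hε, n₀, hn₀⟩ := h d hd v hvpos
  -- e^{-εn} < δ/3 eventually
  have hexp : Tendsto (fun n : ℕ => Real.exp (-(ε * n))) atTop (𝓝 0) := by
    have h1 : Tendsto (fun n : ℕ => ε * (n : ℝ)) atTop atTop :=
      Tendsto.const_mul_atTop hε tendsto_natCast_atTop_atTop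
    exact Real.tendsto_exp_neg_atTop_nhds_zero.comp h1
  obtain ⟨n₁, hn₁⟩ := (Metric.tendsto_atTop.1 hexp) (δ / 3) (by positivity)
  refine ⟨max (max n₀ n₁) 1, fun n hn => ?_⟩
  have hn0 : n₀ ≤ n := le_trans (le_trans (le_max_left _ _) (le_max_left _ _)) hn
  have hn1 : n₁ ≤ n := le_trans (le_trans (le_max_right _ _) (le_max_left _ _)) hn
  have hn2 : 1 ≤ n := le_trans (le_max_right _ _) hn
  have hle := meanSqEndpoint_div_sq_le (d := d) hn2 v
  have hP := hn₀ n hn0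
  have hE := hn₁ n hn1
  rw [Real.dist_eq, sub_zero, abs_of_nonneg (Real.exp_nonneg _)] at hE
  have hnonneg : 0 ≤ meanSqEndpoint d n / (n : ℝ) ^ 2 :=
    div_nonneg (meanSqEndpoint_nonneg d n) (by positivity)
  rw [Real.dist_eq, sub_zero, abs_of_nonneg hnonneg]
  calc meanSqEndpoint d n / (n : ℝ) ^ 2
      ≤ v ^ 2 + ((maxDisplacementEvent d n v).card : ℝ) / (count d n : ℝ) := hle
    _ ≤ δ / 3 + Real.exp (-(ε * n)) := by rw [hv2]; exact add_le_add le_rfl hP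
    _ < δ / 3 + δ / 3 := by linarith
    _ < δ := by linarith

end Literature.Probability.RandomPlanarGeometry.SAW.Zd
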